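import Summits.Ventures.PercRepro.C026PFunHalfEM

/-!
# Vertex-disjoint unions of skeletons (p6, gen 16; the «pieces» of mine-3 §28)

Two edge sets `F₀`, `F₁` are VERTEX-DISJOINT (`VDisjoint`) when no edge of one shares an endpoint
with an edge of the other.  A configuration inside `F₀ ∪ F₁` is the `join` of a configuration inside
`F₀` and one inside `F₁` (`sum_configsIn_union`), and its clusters are the clusters of the two parts
(closed cut, `clusterF_join_left / _right`): with `ρ = ∏_v (2 − x_v)`,

`ρ·n̄(ω₀ ⊔ ω₁) = n̄(ω₀)·n̄(ω₁)`, `ρ·N_c(ω₀ ⊔ ω₁) = N_c(ω₀)·n̄(ω₁)` (`c` not touched by `F₁`),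

because every vertex not touched by a part is isolated in that part's configurations.
-/

namespace PercRepro

namespace MultiGraph

open Finset

variable {V E : Type*} [Fintype V] [DecidableEq V] [Fintype E] [DecidableEq E] {G : MultiGraph V E}

/-! ### Joining configurations of disjoint edge sets -/

section Join

omit [Fintype V] [DecidableEq V] in
/-- The union of two configurations. -/
def join (ω₀ ω₁ : Config E) : Config E := fun e => ω₀ e || ω₁ e

omit [Fintype V] [DecidableEq V] [Fintype E] in
/-- The restriction of a configuration to an edge set. -/
def restrict (F : Finset E) (ω : Config E) : Config E := fun e => decide (e ∈ F) && ω e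

omit [Fintype V] [DecidableEq V] [Fintype E] [DecidableEq E] in
/-- The join, pointwise. -/
theorem join_apply (ω₀ ω₁ : Config E) (e : E) : join ω₀ ω₁ e = (ω₀ e || ω₁ e) := rfl

omit [Fintype V] [DecidableEq V] [Fintype E] in
/-- The restriction, pointwise. -/
theorem restrict_apply (F : Finset E) (ω : Config E) (e : E) :
    restrict F ω e = (decide (e ∈ F) && ω e) := rfl

omit [Fintype V] [DecidableEq V] in
/-- The join of configurations inside `F₀` and `F₁` lies inside `F₀ ∪ F₁`. -/
theorem join_mem_configsIn {F₀ F₁ : Finset E} {ω₀ ω₁ : Config E} (h₀ : ω₀ ∈ configsIn F₀)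
    (h₁ : ω₁ ∈ configsIn F₁) : join ω₀ ω₁ ∈ configsIn (F₀ ∪ F₁) := by
  rw [mem_configsIn] at h₀ h₁ ⊢
  intro e he
  rw [join_apply, Bool.or_eq_true] at he
  rcases he with he | he
  · exact Finset.mem_union_left _ (h₀ e he)
  · exact Finset.mem_union_right _ (h₁ e he)

omit [Fintype V] [DecidableEq V] in
/-- A restriction lies inside the restricting set. -/
theorem restrict_mem_configsIn (F : Finset E) (ω : Config E) : restrict F ω ∈ configsIn F := by
  rw [mem_configsIn]
  intro e he
  rw [restrict_apply, Bool.and_eq_true, decide_eq_true_eq] at he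
  exact he.1

omit [Fintype V] [DecidableEq V] in
/-- Restricting a configuration inside `F` to `F` changes nothing. -/
theorem restrict_of_mem_configsIn {F : Finset E} {ω : Config E} (h : ω ∈ configsIn F) :
    restrict F ω = ω := by
  funext e
  rw [restrict_apply]
  cases he : ω e
  · simp
  · simp [(mem_configsIn.1 h) e he]

omit [Fintype V] [DecidableEq V] in
/-- Restricting a configuration inside `F₁` to a set disjoint from `F₁` gives the all-closed one. -/
theorem restrict_eq_false_of_disjoint {F₀ F₁ : Finset E} (hd : Disjoint F₀ F₁) {ω : Config E}
    (h : ω ∈ configsIn F₁) : restrict F₀ ω = fun _ => false := by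
  funext e
  rw [restrict_apply]
  cases he : ω e
  · simp
  · have := (mem_configsIn.1 h) e he
    simp [Finset.disjoint_right.1 hd this]

omit [Fintype V] [DecidableEq V] in
/-- The restriction of a join to the first (disjoint) part. -/
theorem restrict_join_left {F₀ F₁ : Finset E} (hd : Disjoint F₀ F₁) {ω₀ ω₁ : Config E}
    (h₀ : ω₀ ∈ configsIn F₀) (h₁ : ω₁ ∈ configsIn F₁) : restrict F₀ (join ω₀ ω₁) = ω₀ := by
  funext e
  rw [restrict_apply, join_apply]
  cases he₀ : ω₀ e
  · cases he₁ : ω₁ e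
    · simp
    · have := (mem_configsIn.1 h₁) e he₁
      simp [Finset.disjoint_right.1 hd this]
  · simp [(mem_configsIn.1 h₀) e he₀]

omit [Fintype V] [DecidableEq V] in
/-- The restriction of a join to the second (disjoint) part. -/
theorem restrict_join_right {F₀ F₁ : Finset E} (hd : Disjoint F₀ F₁) {ω₀ ω₁ : Config E}
    (h₀ : ω₀ ∈ configsIn F₀) (h₁ : ω₁ ∈ configsIn F₁) : restrict F₁ (join ω₀ ω₁) = ω₁ := by
  funext e
  rw [restrict_apply, join_apply]
  cases he₁ : ω₁ e
  · cases he₀ : ω₀ e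
    · simp
    · have := (mem_configsIn.1 h₀) e he₀
      simp [Finset.disjoint_left.1 hd this]
  · simp [(mem_configsIn.1 h₁) e he₁]

omit [Fintype V] [DecidableEq V] in
/-- A configuration inside `F₀ ∪ F₁` is the join of its restrictions. -/
theorem join_restrict {F₀ F₁ : Finset E} {ω : Config E} (h : ω ∈ configsIn (F₀ ∪ F₁)) :
    join (restrict F₀ ω) (restrict F₁ ω) = ω := by
  funext e
  rw [join_apply, restrict_apply, restrict_apply]
  cases he : ω e
  · simp
  · have := (mem_configsIn.1 h) e he
    rw [Finset.mem_union] at this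
    rcases this with h0 | h1
    · simp [h0]
    · simp [h1]

omit [Fintype V] [DecidableEq V] in
/-- **Sums over a disjoint union of edge sets factor through the join.** -/
theorem sum_configsIn_union {F₀ F₁ : Finset E} (hd : Disjoint F₀ F₁) (f : Config E → ℝ) :
    ∑ ω ∈ configsIn (F₀ ∪ F₁), f ω =
      ∑ ω₀ ∈ configsIn F₀, ∑ ω₁ ∈ configsIn F₁, f (join ω₀ ω₁) := by
  rw [← Finset.sum_product']
  refine Finset.sum_nbij' (fun ω => (restrict F₀ ω, restrict F₁ ω)) (fun p => join p.1 p.2) ?_ ?_ ?_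
    ?_ ?_
  · intro ω _
    exact Finset.mk_mem_product (restrict_mem_configsIn F₀ ω) (restrict_mem_configsIn F₁ ω)
  · intro p hp
    rw [Finset.mem_product] at hp
    exact join_mem_configsIn hp.1 hp.2
  · intro ω hω
    exact join_restrict hω
  · intro p hp
    rw [Finset.mem_product] at hp
    rw [restrict_join_left hd hp.1 hp.2, restrict_join_right hd hp.1 hp.2]
  · intro ω hω
    simp only
    rw [join_restrict hω]

end Join

/-! ### Vertex-disjoint edge sets and the closed cut -/

section VDisjoint

omit [Fintype V] [DecidableEq V] [Fintype E] [DecidableEq E] in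
/-- `G.Touches F v`: some edge of `F` has `v` as an endpoint. -/
def Touches (G : MultiGraph V E) (F : Finset E) (v : V) : Prop :=
  ∃ f ∈ F, G.fst f = v ∨ G.snd f = v

omit [Fintype V] [DecidableEq V] [Fintype E] [DecidableEq E] in
/-- `G.VDisjoint F₀ F₁`: no vertex is touched by both `F₀` and `F₁`. -/
def VDisjoint (G : MultiGraph V E) (F₀ F₁ : Finset E) : Prop :=
  ∀ v, G.Touches F₀ v → ¬ G.Touches F₁ v

omit [Fintype V] [DecidableEq V] [Fintype E] [DecidableEq E] in
/-- Vertex-disjointness is symmetric. -/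
theorem VDisjoint.symm {F₀ F₁ : Finset E} (h : G.VDisjoint F₀ F₁) : G.VDisjoint F₁ F₀ :=
  fun v h₁ h₀ => h v h₀ h₁

omit [Fintype V] [DecidableEq V] [Fintype E] [DecidableEq E] in
/-- Vertex-disjoint edge sets are disjoint. -/
theorem VDisjoint.disjoint {F₀ F₁ : Finset E} (h : G.VDisjoint F₀ F₁) : Disjoint F₀ F₁ := by
  rw [Finset.disjoint_left]
  intro f h₀ h₁
  exact h (G.fst f) ⟨f, h₀, Or.inl rfl⟩ ⟨f, h₁, Or.inl rfl⟩

omit [Fintype V] [DecidableEq V] in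
/-- The endpoints of an open edge of a configuration inside `F` are touched by `F`. -/
theorem touches_of_open {F : Finset E} {ω : Config E} (hω : ω ∈ configsIn F) {f : E}
    (hf : ω f = true) : G.Touches F (G.fst f) ∧ G.Touches F (G.snd f) :=
  ⟨⟨f, (mem_configsIn.1 hω) f hf, Or.inl rfl⟩, ⟨f, (mem_configsIn.1 hω) f hf, Or.inr rfl⟩⟩

omit [Fintype V] [DecidableEq V] in
/-- **Closed cut**: in a join of configurations of vertex-disjoint edge sets, a vertex not touched
by `F₁` is connected exactly as in the first configuration. -/
theorem conn_join_left_iff {F₀ F₁ : Finset E} (hd : G.VDisjoint F₀ F₁) {ω₀ ω₁ : Config E}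
    (h₀ : ω₀ ∈ configsIn F₀) (h₁ : ω₁ ∈ configsIn F₁) {v : V} (hv : ¬ G.Touches F₁ v) (w : V) :
    G.Conn (join ω₀ ω₁) v w ↔ G.Conn ω₀ v w := by
  constructor
  · intro h
    refine (Conn.induction (motive := fun w => ¬ G.Touches F₁ w ∧ G.Conn ω₀ v w) ⟨hv, Conn.refl G ω₀ v⟩
      ?_ h).2
    intro a b _ hab ih
    obtain ⟨f, hf, hend⟩ := hab
    rw [join_apply, Bool.or_eq_true] at hf
    rcases hf with hf | hf
    · have ht := touches_of_open (G := G) h₀ hf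
      refine ⟨?_, ih.2.trans (Conn.of_openAdj ⟨f, hf, hend⟩)⟩
      rcases hend with ⟨_, rfl⟩ | ⟨rfl, _⟩
      · exact hd _ ht.2
      · exact hd _ ht.1
    · have ht := touches_of_open (G := G) h₁ hf
      exfalso
      rcases hend with ⟨rfl, _⟩ | ⟨_, rfl⟩
      · exact ih.1 ht.1
      · exact ih.1 ht.2
  · intro h
    exact h.mono fun e he => by
      rw [join_apply, he]
      rfl

omit [DecidableEq V] in
/-- The cluster of a vertex not touched by `F₁` in a join is its cluster in the first part. -/
theorem clusterF_join_left {F₀ F₁ : Finset E} (hd : G.VDisjoint F₀ F₁) {ω₀ ω₁ : Config E}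
    (h₀ : ω₀ ∈ configsIn F₀) (h₁ : ω₁ ∈ configsIn F₁) {v : V} (hv : ¬ G.Touches F₁ v) :
    G.clusterF (join ω₀ ω₁) v = G.clusterF ω₀ v := by
  ext w
  rw [mem_clusterF, mem_clusterF]
  exact conn_join_left_iff hd h₀ h₁ hv w

omit [Fintype V] [DecidableEq V] [Fintype E] [DecidableEq E] in
/-- The join is symmetric. -/
theorem join_comm (ω₀ ω₁ : Config E) : join ω₀ ω₁ = join ω₁ ω₀ := by
  funext e
  rw [join_apply, join_apply, Bool.or_comm]

omit [DecidableEq V] in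
/-- The cluster of a vertex not touched by `F₀` in a join is its cluster in the second part. -/
theorem clusterF_join_right {F₀ F₁ : Finset E} (hd : G.VDisjoint F₀ F₁) {ω₀ ω₁ : Config E}
    (h₀ : ω₀ ∈ configsIn F₀) (h₁ : ω₁ ∈ configsIn F₁) {v : V} (hv : ¬ G.Touches F₀ v) :
    G.clusterF (join ω₀ ω₁) v = G.clusterF ω₁ v := by
  rw [join_comm]
  exact clusterF_join_left hd.symm h₁ h₀ hv

omit [DecidableEq V] in
/-- A vertex not touched by `F` is isolated in every configuration inside `F`. -/
theorem clusterF_eq_singleton_of_not_touches {F : Finset E} {ω : Config E} (hω : ω ∈ configsIn F)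
    {v : V} (hv : ¬ G.Touches F v) : G.clusterF ω v = {v} := by
  ext w
  rw [mem_clusterF, Finset.mem_singleton]
  constructor
  · intro h
    refine eq_of_conn_of_isolated (fun f hf => ?_) h
    have ht := touches_of_open (G := G) hω hf
    exact ⟨fun h' => hv (h' ▸ ht.1), fun h' => hv (h' ▸ ht.2)⟩
  · rintro rfl
    exact Conn.refl G ω w

end VDisjoint

end MultiGraph

end PercRepro
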